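import Mathlib.Analysis.SpecialFunctions.Pow.Real
import Literature.AlgebraicGeometry.Frobenioids.ArchimedeanRegionCalculus
import Literature.AlgebraicGeometry.Frobenioids.CircleOpensProofs2
import Literature.AlgebraicGeometry.Frobenioids.CircleOpensSubarcs
import Literature.AlgebraicGeometry.Frobenioids.CategoriesFactorization
import HarnessLib

/-!
# Frobenioids II, §3: powers of arcs — `A^{⊗n} = {aⁿ}`, and nested arcs with equal powers coincide
# (abc-iut cell, layer L1, toolkit for node `FrdII:Prop3.4(viii)/P34-L12`, chain LC-L1-2)

Mochizuki, *The geometry of Frobenioids II: poly-Frobenioids*, Kyushu J. Math. **62** (2008)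
401–460, §3: Definition 3.1 (iii) p. 24 ("`A_L^{⊗d}`"), Lemma 3.2 (iv) p. 25 ("angular regions never
shrink"), and the proof of Proposition 3.4 (viii), journal p. 427 (= kurims p. 32)
[cite: MochizukiFrdII2008, Prop 3.4 (viii) p.32]: "since `β_j` is a prime-Frobenius morphism, it
follows immediately from the fact that `β_j` induces a bijection on underlying angular regions that
`β_j` is irreducible".

PROOF-ONLY file (nothing defined): the elementary circle geometry behind that bijection, used by the
`A₀`-case of the FSMI-factorisation (sub-DAG row `P34-L12`).
* `CircleAux2.pow_eq_image_pow` / `NormOne.pow_eq_image_pow`: for a [nonempty] connected open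
  `A ⊆ S¹` and `n ≥ 1`, the pointwise power `A^n` (the angular part of `A^{⊗n}`) IS the image `φ_n(A)`
  (convexity of the lifted interval); hence `AngularRegion.dir_pow_eq_image`,
  `AngularRegion.carrier_pow_eq_image` (`A^{⊗n} = {aⁿ | a ∈ A}`, polar decomposition and `n`-th roots
  of positive reals) and `AngularRegion.injOn_pow_carrier_of_dir` (injectivity of `a ↦ aⁿ` on `A` from
  injectivity of `z ↦ zⁿ` on the angular part).
* `CircleAux2.sub_le_of_injOn_pow`: `z ↦ zⁿ` injective on an arc forces angular width `≤ 2π/n`;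
  `CircleAux2.eq_of_subset_of_pow_subset` / `NormOne.eq_of_subset_of_pow_subset`: nested connected
  open `B₁ ⊆ B₂` with `B₂^n ⊆ B₁^n` and `z ↦ zⁿ` injective on `B₁` coincide (arc-length bookkeeping over
  `CircleOpensSubarcs`).
* generic: `IsFiberwiseSurjective.of_comp`, `IsFiberwiseSurjective.of_comp_mono`,
  `IsIrreducibleHom.comp_isIso` ([FrdI] §0 vocabulary).
No side is taken on [IUTchIII] Cor. 3.12.
-/

namespace Literature.AlgebraicGeometry.Frobenioids

open CategoryTheory Set
open scoped Pointwise

noncomputable section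

namespace ArchFrd

/-- `u ↦ u/|u|` commutes with powers (local copy of `C0.unitPart_pow_eq`, to keep this toolkit's
imports light). [cite: MochizukiFrdII2008, Def 3.1 (ii) p.23] -/
private theorem unitPart_pow_aux (u : ℂˣ) : ∀ n : ℕ, unitPart ℂ (u ^ n) = unitPart ℂ u ^ n
  | 0 => by rw [pow_zero, pow_zero, unitPart_one]
  | n + 1 => by rw [pow_succ, pow_succ, unitPart_mul, unitPart_pow_aux u n]

/-! ### Powers of connected open subsets of `S¹`: the pointwise power is the image of `z ↦ zⁿ` -/

namespace CircleAux2

open Real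

/-- `exp(i·(U + V)) = exp(i·U) · exp(i·V)`. [cite: MochizukiFrdII2008, Lem 3.2 p.25] -/
theorem exp_image_add (U V : Set ℝ) :
    Circle.exp '' (U + V) = Circle.exp '' U * Circle.exp '' V := by
  ext z
  simp only [Set.mem_image, Set.mem_add, Set.mem_mul]
  constructor
  · rintro ⟨_, ⟨u, hu, v, hv, rfl⟩, rfl⟩
    exact ⟨_, ⟨u, hu, rfl⟩, _, ⟨v, hv, rfl⟩, (Circle.exp_add u v).symm⟩
  · rintro ⟨_, ⟨u, hu, rfl⟩, _, ⟨v, hv, rfl⟩, rfl⟩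
    exact ⟨u + v, ⟨u, hu, v, hv, rfl⟩, Circle.exp_add u v⟩

/-- Sums of open intervals: `(a, b) + (c, d) = (a + c, b + d)`. [cite: MochizukiFrdII2008, Lem 3.2 p.25] -/
theorem Ioo_add_Ioo_eq {a b c d : ℝ} (hab : a < b) (hcd : c < d) :
    Ioo a b + Ioo c d = Ioo (a + c) (b + d) := by
  ext x
  simp only [Set.mem_add, Set.mem_Ioo]
  constructor
  · rintro ⟨y, ⟨hy1, hy2⟩, z, ⟨hz1, hz2⟩, rfl⟩
    exact ⟨by linarith, by linarith⟩
  · rintro ⟨hx1, hx2⟩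
    set t : ℝ := (x - (a + c)) / ((b + d) - (a + c)) with ht
    have hden : 0 < (b + d) - (a + c) := by linarith
    have ht0 : 0 < t := div_pos (by linarith) hden
    have ht1 : t < 1 := (div_lt_one hden).mpr (by linarith)
    refine ⟨a + t * (b - a), ⟨by nlinarith, by nlinarith⟩, c + t * (d - c), ⟨by nlinarith, by nlinarith⟩, ?_⟩
    have : t * ((b + d) - (a + c)) = x - (a + c) := div_mul_cancel₀ _ hden.ne'
    linarith

/-- The `(n+1)`-fold pointwise power of an open arc `exp(i·(c, d))` is the arc
`exp(i·((n+1)c, (n+1)d))`. [cite: MochizukiFrdII2008, Lem 3.2 p.25] -/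
theorem exp_image_Ioo_pow {c d : ℝ} (hcd : c < d) :
    ∀ n : ℕ, (Circle.exp '' Ioo c d) ^ (n + 1) =
      Circle.exp '' Ioo (((n : ℝ) + 1) * c) (((n : ℝ) + 1) * d)
  | 0 => by simp
  | n + 1 => by
    rw [pow_succ, exp_image_Ioo_pow hcd n, ← exp_image_add,
      Ioo_add_Ioo_eq (mul_lt_mul_of_pos_left hcd (by positivity)) hcd]
    push_cast
    ring_nf

/-- The image of an open arc `exp(i·(c, d))` under `z ↦ zⁿ` is the arc `exp(i·(nc, nd))`.
[cite: MochizukiFrdII2008, Lem 3.2 p.25] -/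
theorem image_pow_exp_image_Ioo (c d : ℝ) {n : ℕ} (hn : 0 < n) :
    (fun z : Circle => z ^ n) '' (Circle.exp '' Ioo c d) = Circle.exp '' Ioo ((n : ℝ) * c) ((n : ℝ) * d) := by
  have h1 : (fun z : Circle => z ^ n) = CircleOpens.phi (n : ℤ) := by
    funext z; rw [CircleOpens.phi, zpow_natCast]
  rw [h1, CircleOpens.phi_image_exp_image, Int.cast_natCast,
    Set.image_mul_left_Ioo (by exact_mod_cast hn)]

/-- **Pointwise powers of connected open subsets of `S¹` are images under `z ↦ zⁿ`** (`n ≥ 1`):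
`A^{n} = φ_n(A)` (both are the arc of `n` times the angular width, or all of `S¹`).
[cite: MochizukiFrdII2008, Lem 3.2 p.25] -/
theorem pow_eq_image_pow {A : Set Circle} (hA : IsConnected A) (hAo : IsOpen A) {n : ℕ}
    (hn : 0 < n) : A ^ n = (fun z : Circle => z ^ n) '' A := by
  obtain ⟨m, rfl⟩ : ∃ m, n = m + 1 := ⟨n - 1, by omega⟩
  by_cases hAu : A = univ
  · rw [hAu, Set.univ_pow (Nat.succ_ne_zero m)]
    refine (Set.eq_univ_of_forall fun z => ?_).symm
    obtain ⟨w, hw⟩ := CircleOpens.phi_surjective (n := (m : ℤ) + 1) (by omega) z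
    refine ⟨w, trivial, ?_⟩
    rw [← hw, CircleOpens.phi]
    change w ^ (m + 1) = w ^ ((m : ℤ) + 1)
    rw [← zpow_natCast]; push_cast; rfl
  · obtain ⟨c, d, hcd, -, rfl⟩ := CircleOpens.exists_eq_exp_image_Ioo hA hAo hAu
    rw [exp_image_Ioo_pow hcd m, image_pow_exp_image_Ioo c d (Nat.succ_pos m)]
    push_cast; rfl

end CircleAux2

/-- **Pointwise powers of connected open subsets of `O_ℂ^×` are images under `z ↦ zⁿ`** (`n ≥ 1`;
transport of `CircleAux2.pow_eq_image_pow` along `O_ℂ^× ≅ S¹`): the angular part of `A^{⊗n}` is the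
set of `n`-th powers of directions of `A`. [cite: MochizukiFrdII2008, Def 3.1 (iii) p.24] -/
theorem NormOne.pow_eq_image_pow {B : Set ↥(normOneSubgroup ℂ)} (hB : IsConnected B) (hBo : IsOpen B)
    {n : ℕ} (hn : 0 < n) : B ^ n = (fun z : ↥(normOneSubgroup ℂ) => z ^ n) '' B := by
  obtain ⟨e, h, he, -⟩ := exists_unitCircleEquiv
  have hfun : (h : Circle → ↥(normOneSubgroup ℂ)) = e := funext he
  set A : Set Circle := h ⁻¹' B with hA
  have hBA : B = e '' A := by
    rw [← hfun, Set.image_preimage_eq _ h.surjective]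
  have hAc : IsConnected A := by
    have : A = h.symm '' B := (congrFun h.image_symm B).symm
    rw [this]; exact hB.image _ h.symm.continuous.continuousOn
  have hAo : IsOpen A := h.isOpen_preimage.mpr hBo
  rw [hBA, ← Set.image_pow e A n, CircleAux2.pow_eq_image_pow hAc hAo hn, Set.image_image,
    Set.image_image]
  exact Set.image_congr fun z _ => map_pow e z n

namespace AngularRegion

/-- The angular part of `A^{⊗(n+1)}` is `{z^{n+1} | z ∈ B}`. [cite: MochizukiFrdII2008, Def 3.1 (iii) p.24] -/
theorem dir_pow_eq_image (A : AngularRegion ℂ) (n : ℕ) :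
    A.dir ^ (n + 1) = (fun z : ↥(normOneSubgroup ℂ) => z ^ (n + 1)) '' A.dir :=
  NormOne.pow_eq_image_pow A.isConnected_dir A.isOpen_dir (Nat.succ_pos n)

/-- **`A^{⊗(n+1)} = {a^{n+1} | a ∈ A}`**: every point of the `(n+1)`-fold pointwise product of an
angular region of `ℂ^×` is an `(n+1)`-th power of a point of the region.
[cite: MochizukiFrdII2008, Def 3.1 (iii) p.24] -/
theorem carrier_pow_eq_image (A : AngularRegion ℂ) (n : ℕ) :
    A.carrier ^ (n + 1) = (fun u : ℂˣ => u ^ (n + 1)) '' A.carrier := by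
  refine Subset.antisymm (fun u hu => ?_) ?_
  · obtain ⟨hdir, habs⟩ := (A.mem_carrier_pow_iff n u).1 hu
    rw [A.dir_pow_eq_image n] at hdir
    obtain ⟨z, hz, hzu⟩ := hdir
    -- the `(n+1)`-th root of `|u|`
    have hn : (n + 1 : ℕ) ≠ 0 := Nat.succ_ne_zero n
    let r : PosReal := ⟨((absHom ℂ u : ℝ)) ^ ((↑(n + 1) : ℝ)⁻¹),
      Real.rpow_pos_of_pos (absHom ℂ u).2 _⟩
    have hr : r ^ (n + 1) = absHom ℂ u := by
      apply Subtype.ext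
      rw [Positive.val_pow]
      exact Real.rpow_inv_natCast_pow (absHom ℂ u).2.le hn
    have hrle : r ≤ A.tip := by
      have h1 : r ^ (n + 1) ≤ A.tip ^ (n + 1) := by rw [hr]; exact habs
      by_contra hlt
      push Not at hlt
      have : A.tip ^ (n + 1) < r ^ (n + 1) := by
        rw [← Subtype.coe_lt_coe, Positive.val_pow, Positive.val_pow]
        exact pow_lt_pow_left₀ (Subtype.coe_lt_coe.mpr hlt) A.tip.2.le hn
      exact absurd (lt_of_le_of_lt h1 this) (lt_irrefl _)
    refine ⟨(z : ℂˣ) * ofPosReal ℂ r, (A.coe_mul_ofPosReal_mem_carrier_iff z r).2 ⟨hz, hrle⟩, ?_⟩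
    have hzu' : z ^ (n + 1) = unitPart ℂ u := hzu
    change ((z : ℂˣ) * ofPosReal ℂ r) ^ (n + 1) = u
    rw [mul_pow, ← map_pow, hr, ← Subgroup.coe_pow, hzu']
    exact unitPart_mul_ofPosReal_absHom u
  · rintro _ ⟨a, ha, rfl⟩
    exact Set.pow_mem_pow ha

end AngularRegion

/-! ### Nested arcs with the same power -/

namespace CircleAux2

open Real

/-- `z ↦ zⁿ` is injective on an open arc `exp(i·(a, b))` (`b - a ≤ 2π`) only if its width is at
most `2π/n`. [cite: MochizukiFrdII2008, Lem 3.2 p.25] -/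
theorem sub_le_of_injOn_pow {a b : ℝ} (hlen : b - a ≤ 2 * π) {n : ℕ} (hn : 0 < n)
    (hinj : Set.InjOn (fun z : Circle => z ^ n) (Circle.exp '' Ioo a b)) :
    (n : ℝ) * (b - a) ≤ 2 * π := by
  by_contra hlt
  push Not at hlt
  have hnpos : (0 : ℝ) < n := by exact_mod_cast hn
  -- two points of the arc at angular distance `2π/n`
  set x := (a + b) / 2 - π / n with hx
  set y := (a + b) / 2 + π / n with hy
  have hπn : π / n < (b - a) / 2 := by
    rw [div_lt_iff₀ hnpos]; nlinarith
  have hπn0 : 0 < π / n := div_pos pi_pos hnpos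
  have hxI : x ∈ Ioo a b := ⟨by rw [hx]; linarith, by rw [hx]; linarith⟩
  have hyI : y ∈ Ioo a b := ⟨by rw [hy]; linarith, by rw [hy]; linarith⟩
  have hpow : (Circle.exp x) ^ n = (Circle.exp y) ^ n := by
    rw [← Circle.exp_nsmul, ← Circle.exp_nsmul, nsmul_eq_mul, nsmul_eq_mul, Circle.exp_eq_exp]
    refine ⟨-1, ?_⟩
    rw [hx, hy]; field_simp; ring
  have heq := hinj ⟨x, hxI, rfl⟩ ⟨y, hyI, rfl⟩ hpow
  have hper : Set.InjOn Circle.exp (Ico a (a + 2 * π)) := Circle.exp_injOn_Ico (by linarith)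
  have := hper ⟨hxI.1.le, by linarith [hxI.2]⟩ ⟨hyI.1.le, by linarith [hyI.2]⟩ heq
  have : π / n = 0 := by linarith
  exact absurd this hπn0.ne'

/-- **Nested arcs with the same power coincide**: if `B₁ ⊆ B₂` are [nonempty] connected open subsets
of `S¹`, `z ↦ zⁿ` is injective on `B₁` and `B₂^{n} ⊆ B₁^{n}` (pointwise powers), then `B₁ = B₂`
("angular regions never shrink", cf. Lemma 3.2 (iv); arc-length bookkeeping).
[cite: MochizukiFrdII2008, Lem 3.2 (iv) p.25] -/
theorem eq_of_subset_of_pow_subset {B₁ B₂ : Set Circle} (h₁ : IsConnected B₁) (h₁o : IsOpen B₁)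
    (h₂ : IsConnected B₂) (h₂o : IsOpen B₂) (hsub : B₁ ⊆ B₂) {n : ℕ} (hn : 0 < n)
    (hinj : Set.InjOn (fun z : Circle => z ^ n) B₁) (hpow : B₂ ^ n ⊆ B₁ ^ n) : B₁ = B₂ := by
  have hnpos : (0 : ℝ) < n := by exact_mod_cast hn
  by_cases hB₁ : B₁ = univ
  · exact Subset.antisymm hsub (hB₁ ▸ subset_univ _)
  obtain ⟨a₁, b₁, hab₁, hlen₁, rfl⟩ := CircleOpens.exists_eq_exp_image_Ioo h₁ h₁o hB₁
  have hw₁ := sub_le_of_injOn_pow hlen₁ hn hinj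
  -- `B₁^n` is a proper arc, hence so is `B₂^n`, hence `B₂ ≠ S¹`
  have hB₂ : B₂ ≠ univ := by
    intro hB₂
    rw [hB₂, Set.univ_pow hn.ne', Set.univ_subset_iff, pow_eq_image_pow h₁ h₁o hn,
      image_pow_exp_image_Ioo a₁ b₁ hn] at hpow
    have hmem : Circle.exp ((n : ℝ) * a₁) ∈ Circle.exp '' Ioo ((n : ℝ) * a₁) ((n : ℝ) * b₁) := by
      rw [hpow]; trivial
    exact CircleOpens.exp_left_notMem_exp_image_Ioo (by nlinarith) hmem
  obtain ⟨a₂, b₂, hab₂, hlen₂, rfl⟩ := CircleOpens.exists_eq_exp_image_Ioo h₂ h₂o hB₂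
  -- put `B₁` inside the period of `B₂`
  obtain ⟨a, b, hca, hab, hbd, hlen, heq⟩ := CircleOpens.exists_rep_of_exp_image_Ioo_subset hab₁ hlen₂ hsub
  rw [heq] at hinj hpow ⊢
  have hw : (n : ℝ) * (b - a) ≤ 2 * π := by rw [hlen]; exact hw₁
  -- compare the powers: arcs of angular width `n(b - a) ≤ 2π` containing `exp(i·(na₂, nb₂))`
  rw [pow_eq_image_pow h₂ h₂o hn, image_pow_exp_image_Ioo a₂ b₂ hn,
    pow_eq_image_pow (CircleOpens.isConnected_exp_image_Ioo hab) (CircleOpens.isOpen_exp_image isOpen_Ioo) hn,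
    image_pow_exp_image_Ioo a b hn] at hpow
  have hle := CircleOpens.sub_le_sub_of_exp_image_Ioo_subset (mul_lt_mul_of_pos_left hab₂ hnpos)
    (by nlinarith) hpow
  have hba : b₂ - a₂ ≤ b - a := by nlinarith
  have ha : a = a₂ := le_antisymm (by linarith) hca
  have hb : b = b₂ := le_antisymm hbd (by linarith)
  rw [ha, hb]

end CircleAux2

/-- **Nested arcs of `O_ℂ^×` with the same power coincide** (transport of
`CircleAux2.eq_of_subset_of_pow_subset`). [cite: MochizukiFrdII2008, Lem 3.2 (iv) p.25] -/
theorem NormOne.eq_of_subset_of_pow_subset {B₁ B₂ : Set ↥(normOneSubgroup ℂ)} (h₁ : IsConnected B₁)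
    (h₁o : IsOpen B₁) (h₂ : IsConnected B₂) (h₂o : IsOpen B₂) (hsub : B₁ ⊆ B₂) {n : ℕ} (hn : 0 < n)
    (hinj : Set.InjOn (fun z : ↥(normOneSubgroup ℂ) => z ^ n) B₁) (hpow : B₂ ^ n ⊆ B₁ ^ n) :
    B₁ = B₂ := by
  obtain ⟨e, h, he, -⟩ := exists_unitCircleEquiv
  have hfun : (h : Circle → ↥(normOneSubgroup ℂ)) = e := funext he
  have himg : ∀ B : Set ↥(normOneSubgroup ℂ), B = e '' (h ⁻¹' B) := fun B => by
    rw [← hfun, Set.image_preimage_eq _ h.surjective]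
  have hconn : ∀ B : Set ↥(normOneSubgroup ℂ), IsConnected B → IsConnected (h ⁻¹' B) := fun B hB => by
    have : h ⁻¹' B = h.symm '' B := (congrFun h.image_symm B).symm
    rw [this]; exact hB.image _ h.symm.continuous.continuousOn
  have key := CircleAux2.eq_of_subset_of_pow_subset (hconn _ h₁) (h.isOpen_preimage.mpr h₁o)
    (hconn _ h₂) (h.isOpen_preimage.mpr h₂o) (preimage_mono hsub) hn ?_ ?_
  · rw [himg B₁, himg B₂, key]
  · rintro z₁ hz₁ z₂ hz₂ (heq : z₁ ^ n = z₂ ^ n)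
    have := hinj (show e z₁ ∈ B₁ by rw [← hfun]; exact hz₁) (show e z₂ ∈ B₁ by rw [← hfun]; exact hz₂)
      (by change e z₁ ^ n = e z₂ ^ n; rw [← map_pow, ← map_pow, heq])
    exact e.injective this
  · have hp : ∀ B : Set ↥(normOneSubgroup ℂ), e '' ((h ⁻¹' B) ^ n) = B ^ n := fun B => by
      rw [Set.image_pow, ← himg B]
    intro z hz
    have hz' : e z ∈ B₂ ^ n := by rw [← hp B₂]; exact ⟨z, hz, rfl⟩
    have hz'' := hpow hz'
    rw [← hp B₁] at hz''
    obtain ⟨w, hw, hwe⟩ := hz''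
    rwa [← e.injective hwe]

/-! ### `F₀ = A₀`: generalities, monomorphisms and injectivity on angular regions -/

namespace AngularRegion

/-- If `z ↦ zⁿ` is injective on the angular part of `A`, then `a ↦ aⁿ` is injective on `A`
(polar decomposition). [cite: MochizukiFrdII2008, Rmk 3.3.1 p.29] -/
theorem injOn_pow_carrier_of_dir (A : AngularRegion ℂ) {n : ℕ} (hn : n ≠ 0)
    (h : Set.InjOn (fun z : ↥(normOneSubgroup ℂ) => z ^ n) A.dir) :
    Set.InjOn (fun u : ℂˣ => u ^ n) A.carrier := by
  intro u hu v hv heq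
  change u ^ n = v ^ n at heq
  have habs : absHom ℂ u = absHom ℂ v := by
    have h1 := congrArg (absHom ℂ) heq
    rw [map_pow, map_pow] at h1
    have h2 : ((absHom ℂ u : ℝ)) ^ n = ((absHom ℂ v : ℝ)) ^ n := by
      have := congrArg (fun x : PosReal => (x : ℝ)) h1
      simpa only [Positive.val_pow] using this
    exact Subtype.ext ((pow_left_inj₀ (absHom ℂ u).2.le (absHom ℂ v).2.le hn).1 h2)
  have hdir : unitPart ℂ u = unitPart ℂ v := by
    have h1 := congrArg (unitPart ℂ) heq
    rw [unitPart_pow_aux, unitPart_pow_aux] at h1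
    exact h ((A.mem_carrier_polar_iff u).1 hu).1 ((A.mem_carrier_polar_iff v).1 hv).1 h1
  rw [← unitPart_mul_ofPosReal_absHom u, ← unitPart_mul_ofPosReal_absHom v, habs, hdir]

end AngularRegion

/-! ### Small categorical lemmas -/

section Categorical

variable {E : Type*} [Category E]

/-- The second factor of a fiberwise-surjective composite is fiberwise-surjective.
[cite: MochizukiFrdI2008, §0 p.14] -/
theorem IsFiberwiseSurjective.of_comp {A B C : E} (β : A ⟶ B) (ψ : B ⟶ C)
    (h : IsFiberwiseSurjective (β ≫ ψ)) : IsFiberwiseSurjective ψ := by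
  intro W γ
  obtain ⟨V, δA, δW, hsq⟩ := h γ
  exact ⟨V, δA ≫ β, δW, by rw [Category.assoc, hsq]⟩

/-- The first factor of a fiberwise-surjective composite with monomorphic second factor is
fiberwise-surjective. [cite: MochizukiFrdI2008, §0 p.14] -/
theorem IsFiberwiseSurjective.of_comp_mono {A B C : E} (β : A ⟶ B) (ψ : B ⟶ C) [Mono ψ]
    (h : IsFiberwiseSurjective (β ≫ ψ)) : IsFiberwiseSurjective β := by
  intro W γ
  obtain ⟨V, δA, δW, hsq⟩ := h (γ ≫ ψ)
  refine ⟨V, δA, δW, (cancel_mono ψ).1 ?_⟩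
  rw [Category.assoc, hsq, Category.assoc]

/-- An irreducible arrow followed by an isomorphism is irreducible. [cite: MochizukiFrdI2008, §0 p.17] -/
theorem IsIrreducibleHom.comp_isIso {A B C : E} {β : A ⟶ B} (hβ : IsIrreducibleHom β) (ψ : B ⟶ C)
    [IsIso ψ] : IsIrreducibleHom (β ≫ ψ) := by
  refine ⟨fun hiso => hβ.1 ?_, fun M g h hfac => ?_⟩
  · have : β = (β ≫ ψ) ≫ inv ψ := by rw [Category.assoc, IsIso.hom_inv_id, Category.comp_id]
    rw [this]; infer_instance
  · have hfac' : g ≫ (h ≫ inv ψ) = β := by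
      rw [← Category.assoc, hfac, Category.assoc, IsIso.hom_inv_id, Category.comp_id]
    rcases hβ.2 g (h ≫ inv ψ) hfac' with h1 | h2
    · left
      have : h = (h ≫ inv ψ) ≫ ψ := by rw [Category.assoc, IsIso.inv_hom_id, Category.comp_id]
      rw [this]; infer_instance
    · exact Or.inr h2

end Categorical


end ArchFrd

end

end Literature.AlgebraicGeometry.Frobenioids
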